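import Summits.Ventures.MM22.Rank333.GF2ProfileSets
import HarnessLib

/-!
# ω-census family (a) / cell pub-mm22, v4 (0′) glue at `S ≠ 0`: PROFILE ⇒ ROWS relative to a base constraint list `K`

Cell `pub-mm22` (MatrixMultiplication venture; HOME `run/shared/lean/pub/pub-mm22/`; seat LIT-2 g9, owner per lead
2026-08-23T00:57:03Z of p2's SUB-INSTANCE PROFILE GLUE G1–G4), topic `Summits/Ventures/MM22` (generic in `⟨l,m,n⟩`).
HONEST FRAMING: checker PLUMBING, not a result and not a bound.  `GF2ProfileRows.cert_succ_of_noProfile` is the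
ROOT case (`Cert l m n [] N → … → Cert l m n [] (N+1)`); the cell's per-orbit PROFILE-CERT lift objects (p2:
`494 @ 20` on `487/488/490/491 @ 19`, the dimension-2 lifts `@ 19`) sit at a sub-instance `S_K = subOf l m K ≠` the
full space, and need the same reduction RELATIVE TO `K`:

* (G2) `Represents β prof` — the profile `prof : ι → ℕ` lists bit patterns whose forms AGREE WITH the first forms
  `f_i` of `β : BilinComp (psiK l m n K) ι` on `S_K` (a form on `S_K` has many patterns, all congruent modulo the
  span of `K`'s patterns; no extension is chosen by hand: the tree's covering check `coverB l m K cands` —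
  every pattern reduces by `reduceB K` to `0` or to a listed candidate — yields `exists_represents`: every
  computation with nonzero first forms has a representing profile VALUED IN `cands`, index form);
* (G1) `row_le_sub (hprof : Represents β prof) (h : Cert l m n (K ++ M) b) : b + #{i : prof i ∈ M} ≤ |ι|` — ONE ROW,
  the proof of `row_le` verbatim with `le_rfl ↦ subOf_append_le_subOf` (Wang 2026 Lemma 3 = tree
  `BilinComp.exists_restrictAlong`, stated for a general inclusion `S' ≤ S`);
* (G3) membership ⇒ vanishing is `form_apply_eq_zero_of_mem` on `K ++ M` (rows are cited as `K ++ member list`; a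
  certificate's `Cert l m n (K ++ basis) b` is moved to the member list by the consumer, exactly as at the root);
* (G4) `cert_succ_of_noIndexProfile_sub` / `cert_succ_of_noProfile_sub` / `cert_succ_of_noValidAllSub` — if
  `Cert l m n K N`, the cited rows are `Cert` facts, `coverB l m K cands`, and NO profile `Fin N → cands` is valid
  (`RowsOK`, counting WITH multiplicity — no 0/1 hypothesis), then `Cert l m n K (N + 1)`; all first forms of a
  length-`N` computation of `ψ_K` are nonzero by `Cert K N` itself (`f_ne_zero_of_cert`);
* 0/1: `injective_of_validAllSub` — multiplicity `≤ 1` is forced when every value has a RELATIVE dimension-1 row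
  `Cert l m n (K ++ [f]) (N − 1)` (for `494 @ 20`: the planes through form `84`, printed `≥ 18`), and the set form
  `cert_succ_of_noValidSetSub`; `validAllSub_nil_iff` — at `K = []` this is the root layer (`ValidAll`).

S-nodes at `S ≠ 0` (generators preserving `span K`, action `reduceB K ∘ (f ↦ P·f^(t)·Q)`) are the p1 lineage's
checker business (lead 00:57:03Z); the generic transport lemma they need is `validAllSub_comp` below (any `σ` that
pulls certified `K`-rows back to certified `K`-rows).  Vocabulary sheet: HOME `lit/LIT2-ROWMODEL-DECLS.md`.
-/

namespace Summit.Ventures.MM22.GF2Cert.Profile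

open Summit.MatrixMultiplication.OmegaCensus.GF2RankLB
open Literature.Computability.AlgebraicComplexity
open Module Matrix

variable {l m n : ℕ} {ι : Type*} [Fintype ι]

/-! ## Profiles relative to `K` -/

/-- A profile `prof` **represents** the computation `β` of `ψ_K = XY|_{S_K × 𝔽₂^{m×n}}`: the form of the pattern
`prof i` agrees with the first form `f_i` on `S_K`. -/
def Represents {K : List ℕ} (β : BilinComp (psiK l m n K) ι) (prof : ι → ℕ) : Prop :=
  ∀ i, ∀ u : subOf l m K, β.f i u = form l m (prof i) (u : Matrix (Fin l) (Fin m) (ZMod 2))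

/-- **ONE ROW relative to `K`** (G1): if `S_{K ++ M}` needs `≥ b` products (`Cert l m n (K ++ M) b`), then in every
computation of `ψ_K` the products whose representing pattern is listed in `M` number at most `|ι| − b`
(they vanish on `S_{K ++ M} ≤ S_K`; the others compute `XY|_{S_{K ++ M}}`, Wang 2026 Lemma 3). -/
theorem row_le_sub [DecidableEq ι] {K : List ℕ} (β : BilinComp (psiK l m n K) ι) {prof : ι → ℕ}
    (hprof : Represents β prof) {M : List ℕ} {b : ℕ} (h : Cert l m n (K ++ M) b) :
    b + (Finset.univ.filter fun i => prof i ∈ M).card ≤ Fintype.card ι := by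
  classical
  have hle : subOf l m (K ++ M) ≤ subOf l m K := subOf_append_le_subOf l m K M
  set J : Finset ι := Finset.univ.filter fun i => prof i ∈ M with hJdef
  have hJ : ∀ i ∈ J, ∀ u : subOf l m (K ++ M), β.f i (Submodule.inclusion hle u) = 0 := by
    intro i hi u
    have hmem : prof i ∈ M := (Finset.mem_filter.1 hi).2
    rw [hprof i (Submodule.inclusion hle u), Submodule.coe_inclusion]
    exact form_apply_eq_zero_of_mem (List.mem_append_right K hmem) u
  obtain ⟨γ⟩ := BilinComp.exists_restrictAlong β hle J hJ
  have hb := h _ γ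
  have hJle : J.card ≤ Fintype.card ι := Finset.card_le_univ J
  omega

/-- A representing profile of a length-`N` computation of `ψ_K` is valid against every list of certified
`K`-rows (`rows` = list of `(M, b)` with `Cert l m n (K ++ M) b`). -/
theorem rowsOK_of_represents {K : List ℕ} {N : ℕ} (rows : List (List ℕ × ℕ))
    (hrows : ∀ r ∈ rows, Cert l m n (K ++ r.1) r.2) (β : BilinComp (psiK l m n K) (Fin N)) {prof : Fin N → ℕ}
    (hprof : Represents β prof) : RowsOK N rows prof := by
  classical
  intro r hr
  have h := row_le_sub β hprof (hrows r hr)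
  rwa [Fintype.card_fin] at h

/-- **Validity against ALL certified `K`-rows**: `b + #{i : prof i ∈ M} ≤ N` whenever `Cert l m n (K ++ M) b`. -/
def ValidAllSub (l m n : ℕ) (K : List ℕ) (N : ℕ) (prof : Fin N → ℕ) : Prop :=
  ∀ (M : List ℕ) (b : ℕ), Cert l m n (K ++ M) b → b + (Finset.univ.filter fun i => prof i ∈ M).card ≤ N

/-- A representing profile of a length-`N` computation of `ψ_K` is valid against all certified `K`-rows. -/
theorem validAllSub_of_represents {K : List ℕ} {N : ℕ} (β : BilinComp (psiK l m n K) (Fin N))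
    {prof : Fin N → ℕ} (hprof : Represents β prof) : ValidAllSub l m n K N prof := by
  classical
  intro M b hM
  have h := row_le_sub β hprof hM
  rwa [Fintype.card_fin] at h

/-- `ValidAllSub` implies `RowsOK` for any list of certified `K`-rows. -/
theorem ValidAllSub.rowsOK {K : List ℕ} {N : ℕ} {prof : Fin N → ℕ} (h : ValidAllSub l m n K N prof)
    (rows : List (List ℕ × ℕ)) (hrows : ∀ r ∈ rows, Cert l m n (K ++ r.1) r.2) : RowsOK N rows prof :=
  fun r hr => h r.1 r.2 (hrows r hr)

/-- At `K = []` this is the root layer's `ValidAll`. -/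
theorem validAllSub_nil_iff {N : ℕ} (prof : Fin N → ℕ) : ValidAllSub l m n [] N prof ↔ ValidAll l m n N prof :=
  Iff.rfl

/-- **Transport of validity along a pattern map** (the S-node step at `S ≠ 0`, generic): if `σ` pulls every
certified `K`-row back to a certified `K`-row (`Cert (K ++ M) b → Cert (K ++ σ⁻¹M) b`, preimage among patterns
`< 2^(l m)`), then validity of `prof` gives validity of `σ ∘ prof`. -/
theorem validAllSub_comp {K : List ℕ} {N : ℕ} (σ : ℕ → ℕ)
    (hσ : ∀ (M : List ℕ) (b : ℕ), Cert l m n (K ++ M) b → Cert l m n (K ++ preimRow l m σ M) b)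
    {prof : Fin N → ℕ} (hlt : ∀ i, prof i < 2 ^ (l * m)) (h : ValidAllSub l m n K N prof) :
    ValidAllSub l m n K N (fun i => σ (prof i)) := by
  classical
  intro M b hM
  have h1 := h _ b (hσ M b hM)
  have he : (Finset.univ.filter fun i => prof i ∈ preimRow l m σ M) =
      (Finset.univ.filter fun i => σ (prof i) ∈ M) := by
    ext i
    simp only [Finset.mem_filter, Finset.mem_univ, true_and, mem_preimRow]
    exact ⟨fun h => h.2, fun h => ⟨hlt i, h⟩⟩
  rwa [he] at h1

/-! ## Existence of representing profiles (G2) -/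

/-- In a computation of `ψ_K` of length exactly the certified bound, every first form is nonzero (dropping a
zero form would leave a shorter computation of `ψ_K`). -/
theorem f_ne_zero_of_cert {K : List ℕ} {N : ℕ} (hN : Cert l m n K N) (β : BilinComp (psiK l m n K) (Fin N))
    (i : Fin N) : β.f i ≠ 0 := by
  classical
  intro hi
  have hJ : ∀ j ∈ ({i} : Finset (Fin N)), ∀ u : subOf l m K, β.f j (Submodule.inclusion le_rfl u) = 0 := by
    intro j hj u
    rw [Finset.mem_singleton.1 hj, hi]
    rfl
  obtain ⟨γ⟩ := BilinComp.exists_restrictAlong β le_rfl {i} hJ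
  have := hN _ γ
  simp only [Fintype.card_fin, Finset.card_singleton] at this
  have hpos : 0 < N := Fin.pos i
  omega

/-- **Representing profiles exist, valued in any covering candidate list**: if every pattern reduces modulo `K`
(`reduceB K`) to `0` or to a member of `cands` (`coverB l m K cands`), a computation of `ψ_K` with nonzero first
forms is represented by `i ↦ cands[idx i]` for some index profile `idx`. -/
theorem exists_represents {K cands : List ℕ} (hcov : coverB l m K cands = true)
    (β : BilinComp (psiK l m n K) ι) (hnz : ∀ i, β.f i ≠ 0) :
    ∃ idx : ι → Fin cands.length, Represents β fun i => cands.get (idx i) := by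
  have hc := cover_of_coverB (l := l) (m := m) hcov
  have h01 : ∀ a : ZMod 2, a ≠ 0 → a = 1 := by decide
  have key : ∀ i, ∃ j : Fin cands.length, ∀ u : subOf l m K,
      β.f i u = form l m (cands.get j) (u : Matrix (Fin l) (Fin m) (ZMod 2)) := by
    intro i
    obtain ⟨j, a, ha, hj⟩ := hc (β.f i) (hnz i)
    refine ⟨j, fun u => ?_⟩
    rw [hj u, h01 a ha, one_mul, candF, List.getD_eq_getElem _ _ j.2, ← List.get_eq_getElem]
  choose idx hidx using key
  exact ⟨idx, hidx⟩

/-! ## The assembly (G4) -/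

/-- **«No valid `N`-profile ⇒ `N + 1`», relative to `K`, indexed form**: if every computation of `ψ_K` has `≥ N`
products, every cited `K`-row is certified, `cands` covers the forms on `S_K`, and no index profile
`idx : Fin N → Fin |cands|` makes `i ↦ cands[idx i]` valid (`RowsOK`, with multiplicity), then every computation of
`ψ_K` has `≥ N + 1` products. -/
theorem cert_succ_of_noIndexProfile_sub {N : ℕ} {K : List ℕ} (hN : Cert l m n K N) (rows : List (List ℕ × ℕ))
    (hrows : ∀ r ∈ rows, Cert l m n (K ++ r.1) r.2) (cands : List ℕ) (hcov : coverB l m K cands = true)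
    (hno : ∀ idx : Fin N → Fin cands.length, RowsOK N rows (fun i => cands.get (idx i)) → False) :
    Cert l m n K (N + 1) := by
  classical
  intro r β
  have hNr : N ≤ r := hN r β
  by_contra hlt
  have hrN : r = N := by omega
  subst hrN
  obtain ⟨idx, hidx⟩ := exists_represents hcov β (f_ne_zero_of_cert hN β)
  exact hno idx (rowsOK_of_represents rows hrows β hidx)

/-- **Value form** of `cert_succ_of_noIndexProfile_sub`: no profile `Fin N → ℕ` valued in `cands` is valid. -/
theorem cert_succ_of_noProfile_sub {N : ℕ} {K : List ℕ} (hN : Cert l m n K N) (rows : List (List ℕ × ℕ))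
    (hrows : ∀ r ∈ rows, Cert l m n (K ++ r.1) r.2) (cands : List ℕ) (hcov : coverB l m K cands = true)
    (hno : ∀ prof : Fin N → ℕ, (∀ i, prof i ∈ cands) → RowsOK N rows prof → False) :
    Cert l m n K (N + 1) :=
  cert_succ_of_noIndexProfile_sub hN rows hrows cands hcov fun idx hok =>
    hno _ (fun i => List.get_mem cands (idx i)) hok

/-- **`ValidAllSub` form**: no profile valued in `cands` is valid against ALL certified `K`-rows ⇒ `N + 1`. -/
theorem cert_succ_of_noValidAllSub {N : ℕ} {K : List ℕ} (hN : Cert l m n K N) (cands : List ℕ)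
    (hcov : coverB l m K cands = true)
    (hno : ∀ prof : Fin N → ℕ, (∀ i, prof i ∈ cands) → ValidAllSub l m n K N prof → False) :
    Cert l m n K (N + 1) := by
  classical
  intro r β
  have hNr : N ≤ r := hN r β
  by_contra hlt
  have hrN : r = N := by omega
  subst hrN
  obtain ⟨idx, hidx⟩ := exists_represents hcov β (f_ne_zero_of_cert hN β)
  exact hno _ (fun i => List.get_mem cands (idx i)) (validAllSub_of_represents β hidx)

/-! ## 0/1 and the set form -/

/-- **0/1 relative to `K`**: if every value of the profile has a relative dimension-1 row with bound `N − 1`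
(`Cert l m n (K ++ [prof i]) (N − 1)`, cap `≤ 1`), a profile valid against all certified `K`-rows is injective. -/
theorem injective_of_validAllSub {K : List ℕ} {N : ℕ} {prof : Fin N → ℕ} (h : ValidAllSub l m n K N prof)
    (hs : ∀ i, Cert l m n (K ++ [prof i]) (N - 1)) : Function.Injective prof := by
  classical
  intro i j hij
  by_contra hne
  have h1 := h [prof i] (N - 1) (hs i)
  have he : (Finset.univ.filter fun k => prof k ∈ [prof i]) = (Finset.univ.filter fun k => prof k = prof i) := by
    ext k; simp
  rw [he] at h1
  have h2 : 2 ≤ (Finset.univ.filter fun k => prof k = prof i).card := by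
    have hsub : ({i, j} : Finset (Fin N)) ⊆ Finset.univ.filter fun k => prof k = prof i := by
      intro k hk
      simp only [Finset.mem_insert, Finset.mem_singleton] at hk
      rcases hk with rfl | rfl <;> simp [hij]
    have := Finset.card_le_card hsub
    rwa [Finset.card_pair hne] at this
  have hpos : 0 < N := Fin.pos i
  omega

/-- **Assembly, set form relative to `K` («no valid 0/1 `N`-profile ⇒ `N + 1`»)**: `Cert K N`, a covering
candidate list whose every member has a relative singleton row `Cert l m n (K ++ [f]) (N − 1)`, and «no `N`-subset
`M ⊆ cands` satisfies `b + #(M ∩ L) ≤ N` for every certified `K`-row `(L, b)`» give `Cert l m n K (N + 1)`. -/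
theorem cert_succ_of_noValidSetSub {N : ℕ} {K : List ℕ} (hN : Cert l m n K N) (cands : List ℕ)
    (hcov : coverB l m K cands = true) (hsingle : ∀ f ∈ cands, Cert l m n (K ++ [f]) (N - 1))
    (hno : ∀ M : Finset ℕ, M.card = N → (∀ f ∈ M, f ∈ cands) →
      (∀ (L : List ℕ) (b : ℕ), Cert l m n (K ++ L) b → b + (M.filter fun f => f ∈ L).card ≤ N) → False) :
    Cert l m n K (N + 1) := by
  classical
  refine cert_succ_of_noValidAllSub hN cands hcov fun prof hc hV => ?_
  have hinj : Function.Injective prof := injective_of_validAllSub hV fun i => hsingle _ (hc i)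
  refine hno (profSet prof) (card_profSet hinj) (fun f hf => ?_) (fun L b hL => ?_)
  · obtain ⟨i, rfl⟩ := mem_profSet.1 hf
    exact hc i
  · rw [← card_filter_mem_eq hinj L]
    exact hV L b hL

end Summit.Ventures.MM22.GF2Cert.Profile
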